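/-
Origin: written from primary sources — S. Kudla, *Seesaw dual reductive pairs* (1984) §1 (the see-saw pair
`(U(V), U(W₁) × U(W₂))` inside `Sp(V ⊗ (W₁ ⊕ W₂)) = Sp((V ⊗ W₁) ⊕ (V ⊗ W₂))`); C. Mœglin, M.-F. Vignéras,
J.-L. Waldspurger, *Correspondances de Howe sur un corps p-adique* (1987) Chap. 2 II.1 (transport of structure of the
metaplectic group and of the Weil representation along an isomorphism of symplectic spaces); A. Weil, *Sur certains
groupes d'opérateurs unitaires* (1964) Chap. III n° 37–41. Adapted: no. This file is GLUE between two coordinate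
systems already in the tree: the Kronecker coordinates `(n × (m₁ ⊕ m₂), T_V ⊗ₖ (T₁ ⊕ T₂))` in which a dual pair
`(U(V), U(W₁ ⊕ W₂))` is realised (`UnitaryGroupDirectSum`, `UnitaryDualPairSplittingDatum`), and the block-sum
coordinates `((n × m₁) ⊕ (n × m₂), (T_V ⊗ₖ T₁) ⊕ (T_V ⊗ₖ T₂))` in which the two-factor Schur lemma and the see-saw
character live (`AdelicMetaplecticTensorSchur`, `AdelicMetaplecticSeesawCharacter`). The passage is the composite of
the reindexing of record along `Equiv.prodSumDistrib` (`AdelicMetaplecticReindex`) and the relabelling of record along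
the matrix identity `reindex (T_V ⊗ₖ (T₁ ⊕ T₂)) = (T_V ⊗ₖ T₁) ⊕ (T_V ⊗ₖ T₂)` (`AdelicMetaplecticTransport`,
`reindex_kronecker_fromBlocks_diag`). Kernel only; no records.
-/
import Literature.NumberTheory.Weil1964.AdelicMetaplecticSeesawCharacter
import Literature.NumberTheory.Weil1964.AdelicMetaplecticReindex
import HarnessLib

-- buildfix G11b-3 recipe (LEDGER B13-1/B13-3): elaborate sequentially so the trailing `attribute [implicit_reducible]`
-- block (reducibilityCoreExt is keyed to the async environment branch) is in force at `.olean` export.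
set_option Elab.async false

/-!
# The see-saw character in Kronecker coordinates

Fix a number field `F`, finite index types `n, m₁, m₂` and Gram matrices `T_V : Matrix n n 𝔸_F`,
`T_j : Matrix m_j m_j 𝔸_F`. Write `e := Equiv.prodSumDistrib n m₁ m₂ : n × (m₁ ⊕ m₂) ≃ (n × m₁) ⊕ (n × m₂)`.

* `kronSumTransport F T_V T₁ T₂ : Mp_ψ(W_{T_V ⊗ (T₁ ⊕ T₂)})ᶜᵒⁿᵗ ≃* Mp_ψ(W_{(T_V ⊗ T₁) ⊕ (T_V ⊗ T₂)})ᶜᵒⁿᵗ` — reindex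
  along `e`, then relabel along `reindex_kronecker_fromBlocks_diag`; it is continuous, preserves the `Θ`-fixing
  subgroup (`kronSumTransport_mem_adelicMpTheta_iff`), moves the Weil representation by the function reindexing
  `R_e` (`omega_kronSumTransport_apply`) and the projection `π` by `W_e` (`coe_proj_kronSumTransport_apply`);
* `kronTensor F T_V T₁ T₂ Φ₁ Φ₂ := R_e⁻¹ (Φ₁ ⊠ Φ₂)` — the external tensor read in Kronecker coordinates,
  `(kronTensor Φ₁ Φ₂)(w) = Φ₁ (w(·, inl ·)) · Φ₂ (w(·, inr ·))` (`coe_kronTensor_apply`);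
* for homomorphisms `S : P →* Mp(W_{T_V ⊗ (T₁ ⊕ T₂)})ᶜᵒⁿᵗ`, `s_j : P →* Mp(W_{T_V ⊗ T_j})ᶜᵒⁿᵗ` whose projections are
  see-saw compatible IN KRONECKER COORDINATES —
  `hS : W_e ∘ π(S p) ∘ W_e⁻¹ = π(s₁ p) ⊕ π(s₂ p)` as automorphisms of `W_{(n × m₁) ⊕ (n × m₂)}` (an equality of
  underlying linear equivalences `(…).1 = (…).1`, the shape of unitary-2's
  `IsQuadraticCoordinates.pairToSymplectic_dualPair_blockDiag`) — the block-sum splitting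
  `kronSeesawSplitting S := kronSumTransport ∘ S` satisfies the hypothesis `hs` of `mpSeesawChar` on the nose
  (`proj_kronSeesawSplitting`), whence **`mpSeesawCharKron S s₁ s₂ hS hT₁ hT₂ : P →* ℂˣ`** with
  `ω(S p) (kronTensor Φ₁ Φ₂) = χ(p) • kronTensor (ω(s₁ p) Φ₁) (ω(s₂ p) Φ₂)` (`mpSeesawCharKron_spec`), `χ(p) = 1`
  whenever the three values are `Θ`-fixing (`mpSeesawCharKron_eq_one_of_mem_adelicMpTheta`); by
  `mpSeesawCharKron_def` the whole API of
  `AdelicMetaplecticSeesawCharacter` (twists, the product group `G_V × (U₁ × U₂)`, restrictions, and continuity: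
  `continuous_mpSeesawChar … (continuous_kronSeesawSplitting S hc) hc₁ hc₂`) applies to `kronSeesawSplitting S`.

Provenance / use (Hodge-CM model-construction cell, node W2-⊗ (⊗2)): with this file the `(12)`-side instance of the
see-saw restriction identity of the big oscillator representation is an instantiation at the dual-pair splittings of
`UnitaryDualPairSplittingDatum`: the consumer's `hS` is obtained by rewriting the three `π ∘ s = ι_{V,W}` fields of the
splitting data into unitary-2's `IsQuadraticCoordinates.pairToSymplectic_dualPair_blockDiag` (which is stated as the
same equality of underlying linear equivalences), with no mathematics left over.

Implementation note: all symplectic-group-valued objects are typed through `adelicForm` (the vocabulary of the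
`Weil1964` files) and meet the `UnitaryGroupDirectSum` vocabulary (`spSum`, `spReindex`, `reindexW`) only through
applications of those maps; equalities of elements of (propositionally distinct) symplectic groups are stated as
equalities of underlying linear equivalences `(…).1 = (…).1`. This keeps every statement within default heartbeats.
-/

noncomputable section

open NumberField
open scoped Matrix Kronecker Classical

namespace Literature.NumberTheory.Weil1964

open Literature.RepresentationTheory.HeisenbergGroup Literature.NumberTheory.Automorphic IsDedekindDomain

/-! ## §1 The transport `Mp(W_{T_V ⊗ (T₁ ⊕ T₂)})ᶜᵒⁿᵗ ≃* Mp(W_{(T_V ⊗ T₁) ⊕ (T_V ⊗ T₂)})ᶜᵒⁿᵗ` -/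

section Transport

variable (F : Type) [Field F] [NumberField F] {n m₁ m₂ : Type} [Fintype n] [DecidableEq n] [Fintype m₁]
  [DecidableEq m₁] [Fintype m₂] [DecidableEq m₂]
  (TV : Matrix n n (AdeleRing (𝓞 F) F)) (T₁ : Matrix m₁ m₁ (AdeleRing (𝓞 F) F)) (T₂ : Matrix m₂ m₂ (AdeleRing (𝓞 F) F))

/-- **`((T_V ⊗ T₁) ⊕ (T_V ⊗ T₂)) · 1 = reindex_e (T_V ⊗ (T₁ ⊕ T₂))`** — the matrix identity along which the
relabelling of record (with `C = 1`) is taken. [folklore] -/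
theorem fromBlocks_kronecker_mul_one :
    Matrix.fromBlocks (TV ⊗ₖ T₁) 0 0 (TV ⊗ₖ T₂) *
        ((1 : GL ((n × m₁) ⊕ (n × m₂)) (AdeleRing (𝓞 F) F)) :
          Matrix ((n × m₁) ⊕ (n × m₂)) ((n × m₁) ⊕ (n × m₂)) (AdeleRing (𝓞 F) F)) =
      Matrix.reindex (Equiv.prodSumDistrib n m₁ m₂) (Equiv.prodSumDistrib n m₁ m₂)
        (TV ⊗ₖ Matrix.fromBlocks T₁ 0 0 T₂) := by
  rw [Units.val_one, Matrix.mul_one, UnitaryGroup.reindex_kronecker_fromBlocks_diag]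

/-- **THE TRANSPORT TO BLOCK-SUM COORDINATES** `Mp_ψ(W_{T_V ⊗ (T₁ ⊕ T₂)})ᶜᵒⁿᵗ ≃* Mp_ψ(W_{(T_V ⊗ T₁) ⊕ (T_V ⊗ T₂)})ᶜᵒⁿᵗ`:
reindex along `Equiv.prodSumDistrib n m₁ m₂`, then relabel (with `C = 1`) along `fromBlocks_kronecker_mul_one`.
[cite: MoeglinVignerasWaldspurger1987, Chap. 2 II.1 (A)–(B)] -/
def kronSumTransport :
    adelicMpCont F (n × (m₁ ⊕ m₂)) (TV ⊗ₖ Matrix.fromBlocks T₁ 0 0 T₂) ≃*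
      adelicMpCont F ((n × m₁) ⊕ (n × m₂)) (Matrix.fromBlocks (TV ⊗ₖ T₁) 0 0 (TV ⊗ₖ T₂)) :=
  (adelicMpContReindex F (Equiv.prodSumDistrib n m₁ m₂) (TV ⊗ₖ Matrix.fromBlocks T₁ 0 0 T₂)).trans
    (adelicMpContRelabel F ((n × m₁) ⊕ (n × m₂)) 1 (fromBlocks_kronecker_mul_one F TV T₁ T₂))

/-- Unfolding: `kronSumTransport p = relabel₁ (reindex_e p)`. [folklore] -/
theorem kronSumTransport_apply (p : adelicMpCont F (n × (m₁ ⊕ m₂)) (TV ⊗ₖ Matrix.fromBlocks T₁ 0 0 T₂)) :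
    kronSumTransport F TV T₁ T₂ p =
      adelicMpContRelabel F ((n × m₁) ⊕ (n × m₂)) 1 (fromBlocks_kronecker_mul_one F TV T₁ T₂)
        (adelicMpContReindex F (Equiv.prodSumDistrib n m₁ m₂) (TV ⊗ₖ Matrix.fromBlocks T₁ 0 0 T₂) p) :=
  rfl

/-- **The transport is continuous** (coefficient topologies). [cite: Weil1964, Chap. III n° 39 p. 189] -/
theorem continuous_kronSumTransport : Continuous (kronSumTransport F TV T₁ T₂) :=
  (continuous_adelicMpContRelabel F _ 1 (fromBlocks_kronecker_mul_one F TV T₁ T₂)).comp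
    (continuous_adelicMpContReindex F _ _)

/-- **The transport preserves `Θ`-fixing.** [cite: Weil1964, Chap. III n° 41 Thm 6 p. 193] -/
theorem kronSumTransport_mem_adelicMpTheta_iff
    (p : adelicMpCont F (n × (m₁ ⊕ m₂)) (TV ⊗ₖ Matrix.fromBlocks T₁ 0 0 T₂)) :
    ((kronSumTransport F TV T₁ T₂ p :
        adelicMpCont F ((n × m₁) ⊕ (n × m₂)) (Matrix.fromBlocks (TV ⊗ₖ T₁) 0 0 (TV ⊗ₖ T₂))) :
          adelicMp F ((n × m₁) ⊕ (n × m₂)) (Matrix.fromBlocks (TV ⊗ₖ T₁) 0 0 (TV ⊗ₖ T₂))) ∈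
        adelicMpTheta F ((n × m₁) ⊕ (n × m₂)) (Matrix.fromBlocks (TV ⊗ₖ T₁) 0 0 (TV ⊗ₖ T₂)) ↔
      (p : adelicMp F (n × (m₁ ⊕ m₂)) (TV ⊗ₖ Matrix.fromBlocks T₁ 0 0 T₂)) ∈
        adelicMpTheta F (n × (m₁ ⊕ m₂)) (TV ⊗ₖ Matrix.fromBlocks T₁ 0 0 T₂) :=
  (coe_adelicMpContRelabel_mem_adelicMpTheta_iff F ((n × m₁) ⊕ (n × m₂)) 1
      (fromBlocks_kronecker_mul_one F TV T₁ T₂)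
      (adelicMpContReindex F (Equiv.prodSumDistrib n m₁ m₂) (TV ⊗ₖ Matrix.fromBlocks T₁ 0 0 T₂) p)).trans
    (coe_adelicMpContReindex_mem_adelicMpTheta_iff F _ _ p)

/-- **The Weil representation after transport is the reindexed one**:
`ω(kronSumTransport p) Ψ = R_e (ω(p) (R_e⁻¹ Ψ))`. [cite: MoeglinVignerasWaldspurger1987, Chap. 2 II.1 (B)] -/
theorem omega_kronSumTransport_apply (p : adelicMpCont F (n × (m₁ ⊕ m₂)) (TV ⊗ₖ Matrix.fromBlocks T₁ 0 0 T₂))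
    (Ψ : piSchwartzBruhat F ((n × m₁) ⊕ (n × m₂))) :
    adelicMpCont.omega F ((n × m₁) ⊕ (n × m₂)) (Matrix.fromBlocks (TV ⊗ₖ T₁) 0 0 (TV ⊗ₖ T₂))
        (kronSumTransport F TV T₁ T₂ p) Ψ =
      piSBReindex F (Equiv.prodSumDistrib n m₁ m₂)
        (adelicMpCont.omega F (n × (m₁ ⊕ m₂)) (TV ⊗ₖ Matrix.fromBlocks T₁ 0 0 T₂) p
          ((piSBReindex F (Equiv.prodSumDistrib n m₁ m₂)).symm Ψ)) :=
  (LinearMap.congr_fun (adelicMpCont.omega_relabel F ((n × m₁) ⊕ (n × m₂)) 1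
      (fromBlocks_kronecker_mul_one F TV T₁ T₂)
      (adelicMpContReindex F (Equiv.prodSumDistrib n m₁ m₂) (TV ⊗ₖ Matrix.fromBlocks T₁ 0 0 T₂) p)) Ψ).trans
    (adelicMpCont.omega_reindex_apply F _ _ p Ψ)

/-- `Λ₁⁻¹ = id`: the relabelling vector map with `C = 1` is the identity. [folklore] -/
theorem relabelVec_one_symm_apply {ι : Type} [Fintype ι] [DecidableEq ι]
    (w : (ι → AdeleRing (𝓞 F) F) × (ι → AdeleRing (𝓞 F) F)) : (relabelVec F ι 1).symm w = w := by
  rw [LinearEquiv.symm_apply_eq]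
  change w = (w.1, ((1 : GL ι (AdeleRing (𝓞 F) F)) : Matrix ι ι (AdeleRing (𝓞 F) F)) *ᵥ w.2)
  rw [Units.val_one, Matrix.one_mulVec]

/-- `Λ₁ = id`. [folklore] -/
theorem relabelVec_one_apply {ι : Type} [Fintype ι] [DecidableEq ι]
    (v : (ι → AdeleRing (𝓞 F) F) × (ι → AdeleRing (𝓞 F) F)) : relabelVec F ι 1 v = v :=
  Prod.ext rfl (by
    change ((1 : GL ι (AdeleRing (𝓞 F) F)) : Matrix ι ι (AdeleRing (𝓞 F) F)) *ᵥ v.2 = v.2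
    rw [Units.val_one, Matrix.one_mulVec])

/-- With `C = 1` the relabelling does not move `π`, pointwise: `π(relabel₁ q) w = π(q) w`. [folklore] -/
theorem coe_proj_adelicMpRelabel_one_apply {ι : Type} [Fintype ι] [DecidableEq ι]
    {T T' : Matrix ι ι (AdeleRing (𝓞 F) F)}
    (h : T * ((1 : GL ι (AdeleRing (𝓞 F) F)) : Matrix ι ι (AdeleRing (𝓞 F) F)) = T') (q : adelicMp F ι T')
    (w : (ι → AdeleRing (𝓞 F) F) × (ι → AdeleRing (𝓞 F) F)) :
    ((MpPsi.proj (adelicSchrodinger F ι T) (adelicMpRelabel F ι 1 h q) : symplecticGroup (polar (adelicForm F ι T))) :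
        ((ι → AdeleRing (𝓞 F) F) × (ι → AdeleRing (𝓞 F) F)) ≃ₗ[AdeleRing (𝓞 F) F]
          ((ι → AdeleRing (𝓞 F) F) × (ι → AdeleRing (𝓞 F) F))) w =
      ((MpPsi.proj (adelicSchrodinger F ι T') q : symplecticGroup (polar (adelicForm F ι T'))) :
        ((ι → AdeleRing (𝓞 F) F) × (ι → AdeleRing (𝓞 F) F)) ≃ₗ[AdeleRing (𝓞 F) F]
          ((ι → AdeleRing (𝓞 F) F) × (ι → AdeleRing (𝓞 F) F))) w := by
  rw [proj_adelicMpRelabel, UnitaryGroup.coe_symplecticGroupCongr_apply, relabelVec_one_symm_apply,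
    relabelVec_one_apply]

/-- **The projection after transport is `W_e π(p) W_e⁻¹`**, pointwise:
`π(kronSumTransport p) w = W_e (π(p) (W_e⁻¹ w))`. [cite: MoeglinVignerasWaldspurger1987, Chap. 2 II.1 (A)] -/
theorem coe_proj_kronSumTransport_apply (p : adelicMpCont F (n × (m₁ ⊕ m₂)) (TV ⊗ₖ Matrix.fromBlocks T₁ 0 0 T₂))
    (w : (((n × m₁) ⊕ (n × m₂)) → AdeleRing (𝓞 F) F) × (((n × m₁) ⊕ (n × m₂)) → AdeleRing (𝓞 F) F)) :
    ((adelicMpCont.proj F ((n × m₁) ⊕ (n × m₂)) (Matrix.fromBlocks (TV ⊗ₖ T₁) 0 0 (TV ⊗ₖ T₂))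
          (kronSumTransport F TV T₁ T₂ p) :
        symplecticGroup (polar (adelicForm F ((n × m₁) ⊕ (n × m₂)) (Matrix.fromBlocks (TV ⊗ₖ T₁) 0 0 (TV ⊗ₖ T₂))))) :
        ((((n × m₁) ⊕ (n × m₂)) → AdeleRing (𝓞 F) F) × (((n × m₁) ⊕ (n × m₂)) → AdeleRing (𝓞 F) F)) ≃ₗ[AdeleRing (𝓞 F) F]
          ((((n × m₁) ⊕ (n × m₂)) → AdeleRing (𝓞 F) F) × (((n × m₁) ⊕ (n × m₂)) → AdeleRing (𝓞 F) F))) w =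
      UnitaryGroup.reindexW (AdeleRing (𝓞 F) F) (Equiv.prodSumDistrib n m₁ m₂)
        (((adelicMpCont.proj F (n × (m₁ ⊕ m₂)) (TV ⊗ₖ Matrix.fromBlocks T₁ 0 0 T₂) p :
            symplecticGroup (polar (adelicForm F (n × (m₁ ⊕ m₂)) (TV ⊗ₖ Matrix.fromBlocks T₁ 0 0 T₂)))) :
            (((n × (m₁ ⊕ m₂)) → AdeleRing (𝓞 F) F) × ((n × (m₁ ⊕ m₂)) → AdeleRing (𝓞 F) F)) ≃ₗ[AdeleRing (𝓞 F) F]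
              (((n × (m₁ ⊕ m₂)) → AdeleRing (𝓞 F) F) × ((n × (m₁ ⊕ m₂)) → AdeleRing (𝓞 F) F)))
          ((UnitaryGroup.reindexW (AdeleRing (𝓞 F) F) (Equiv.prodSumDistrib n m₁ m₂)).symm w)) :=
  (coe_proj_adelicMpRelabel_one_apply F (fromBlocks_kronecker_mul_one F TV T₁ T₂)
      (adelicMpReindex F (Equiv.prodSumDistrib n m₁ m₂) (TV ⊗ₖ Matrix.fromBlocks T₁ 0 0 T₂) p) w).trans
    (coe_proj_adelicMpReindex_apply F (Equiv.prodSumDistrib n m₁ m₂) (TV ⊗ₖ Matrix.fromBlocks T₁ 0 0 T₂) p w)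

end Transport

/-! ### The external tensor in Kronecker coordinates -/

section KronTensor

variable (F : Type) [Field F] [NumberField F] {n m₁ m₂ : Type} [Fintype n] [Fintype m₁] [Fintype m₂]

/-- **`Φ₁ ⊠ Φ₂` read in Kronecker coordinates**: `R_e⁻¹ (Φ₁ ⊠ Φ₂) ∈ 𝒮(𝔸_F^{n × (m₁ ⊕ m₂)})`. [folklore] -/
def kronTensor (Φ₁ : piSchwartzBruhat F (n × m₁)) (Φ₂ : piSchwartzBruhat F (n × m₂)) :
    piSchwartzBruhat F (n × (m₁ ⊕ m₂)) :=
  (piSBReindex F (Equiv.prodSumDistrib n m₁ m₂)).symm (tensorToSum F (n × m₁) (n × m₂) Φ₁ Φ₂)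

/-- Unfolding. [folklore] -/
theorem kronTensor_def (Φ₁ : piSchwartzBruhat F (n × m₁)) (Φ₂ : piSchwartzBruhat F (n × m₂)) :
    kronTensor F Φ₁ Φ₂ =
      (piSBReindex F (Equiv.prodSumDistrib n m₁ m₂)).symm (tensorToSum F (n × m₁) (n × m₂) Φ₁ Φ₂) :=
  rfl

/-- `R_e (kronTensor Φ₁ Φ₂) = Φ₁ ⊠ Φ₂`. [folklore] -/
@[simp] theorem piSBReindex_kronTensor (Φ₁ : piSchwartzBruhat F (n × m₁)) (Φ₂ : piSchwartzBruhat F (n × m₂)) :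
    piSBReindex F (Equiv.prodSumDistrib n m₁ m₂) (kronTensor F Φ₁ Φ₂) =
      tensorToSum F (n × m₁) (n × m₂) Φ₁ Φ₂ :=
  (piSBReindex F (Equiv.prodSumDistrib n m₁ m₂)).apply_symm_apply _

/-- **Values**: `(kronTensor Φ₁ Φ₂)(w) = Φ₁ (fun (i, j) => w (i, inl j)) · Φ₂ (fun (i, k) => w (i, inr k))`. [folklore] -/
theorem coe_kronTensor_apply (Φ₁ : piSchwartzBruhat F (n × m₁)) (Φ₂ : piSchwartzBruhat F (n × m₂))
    (w : (n × (m₁ ⊕ m₂)) → AdeleRing (𝓞 F) F) :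
    (kronTensor F Φ₁ Φ₂ : ((n × (m₁ ⊕ m₂)) → AdeleRing (𝓞 F) F) → ℂ) w =
      (Φ₁ : ((n × m₁) → AdeleRing (𝓞 F) F) → ℂ) (fun q => w (q.1, Sum.inl q.2)) *
        (Φ₂ : ((n × m₂) → AdeleRing (𝓞 F) F) → ℂ) (fun q => w (q.1, Sum.inr q.2)) := by
  rw [kronTensor_def, coe_piSBReindex_symm_apply, coe_tensorToSum, boxTensor_apply]
  simp only [Function.comp_apply, Equiv.prodSumDistrib_symm_apply_left, Equiv.prodSumDistrib_symm_apply_right]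

/-- `kronTensor` is additive in the first slot. [folklore] -/
theorem kronTensor_add_left (Φ₁ Φ₁' : piSchwartzBruhat F (n × m₁)) (Φ₂ : piSchwartzBruhat F (n × m₂)) :
    kronTensor F (Φ₁ + Φ₁') Φ₂ = kronTensor F Φ₁ Φ₂ + kronTensor F Φ₁' Φ₂ := by
  rw [kronTensor_def, kronTensor_def, kronTensor_def, map_add, LinearMap.add_apply, map_add]

/-- `kronTensor` is additive in the second slot. [folklore] -/
theorem kronTensor_add_right (Φ₁ : piSchwartzBruhat F (n × m₁)) (Φ₂ Φ₂' : piSchwartzBruhat F (n × m₂)) :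
    kronTensor F Φ₁ (Φ₂ + Φ₂') = kronTensor F Φ₁ Φ₂ + kronTensor F Φ₁ Φ₂' := by
  rw [kronTensor_def, kronTensor_def, kronTensor_def, map_add, map_add]

/-- `kronTensor` is homogeneous in each slot. [folklore] -/
theorem kronTensor_smul (c d : ℂ) (Φ₁ : piSchwartzBruhat F (n × m₁)) (Φ₂ : piSchwartzBruhat F (n × m₂)) :
    kronTensor F (c • Φ₁) (d • Φ₂) = (c * d) • kronTensor F Φ₁ Φ₂ := by
  simp only [kronTensor_def, map_smul, LinearMap.smul_apply, smul_smul, mul_comm d c]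

end KronTensor

/-! ## §2 The see-saw character of Kronecker-coordinate splittings -/

section Seesaw

variable {F : Type} [Field F] [NumberField F] {n m₁ m₂ : Type} [Fintype n] [DecidableEq n] [Fintype m₁]
  [DecidableEq m₁] [Fintype m₂] [DecidableEq m₂]
  {TV : Matrix n n (AdeleRing (𝓞 F) F)} {T₁ : Matrix m₁ m₁ (AdeleRing (𝓞 F) F)} {T₂ : Matrix m₂ m₂ (AdeleRing (𝓞 F) F)}
  {P : Type*} [Group P]
  (S : P →* adelicMpCont F (n × (m₁ ⊕ m₂)) (TV ⊗ₖ Matrix.fromBlocks T₁ 0 0 T₂))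
  (s₁ : P →* adelicMpCont F (n × m₁) (TV ⊗ₖ T₁)) (s₂ : P →* adelicMpCont F (n × m₂) (TV ⊗ₖ T₂))

/-- **The block-sum splitting** `kronSumTransport ∘ S : P →* Mp(W_{(T_V ⊗ T₁) ⊕ (T_V ⊗ T₂)})ᶜᵒⁿᵗ`. [folklore] -/
def kronSeesawSplitting :
    P →* adelicMpCont F ((n × m₁) ⊕ (n × m₂)) (Matrix.fromBlocks (TV ⊗ₖ T₁) 0 0 (TV ⊗ₖ T₂)) :=
  (kronSumTransport F TV T₁ T₂).toMonoidHom.comp S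

/-- Unfolding. [folklore] -/
@[simp] theorem kronSeesawSplitting_apply (p : P) :
    kronSeesawSplitting S p = kronSumTransport F TV T₁ T₂ (S p) := rfl

/-- The block-sum splitting is continuous along a continuous `S`. [folklore] -/
theorem continuous_kronSeesawSplitting [TopologicalSpace P] (hc : Continuous S) :
    Continuous (kronSeesawSplitting S) :=
  (continuous_kronSumTransport F TV T₁ T₂).comp hc

/-- `Θ`-fixing values are preserved. [cite: Weil1964, Chap. III n° 41 Thm 6 p. 193] -/
theorem kronSeesawSplitting_mem_adelicMpTheta_iff (p : P) :
    ((kronSeesawSplitting S p :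
        adelicMpCont F ((n × m₁) ⊕ (n × m₂)) (Matrix.fromBlocks (TV ⊗ₖ T₁) 0 0 (TV ⊗ₖ T₂))) :
          adelicMp F ((n × m₁) ⊕ (n × m₂)) (Matrix.fromBlocks (TV ⊗ₖ T₁) 0 0 (TV ⊗ₖ T₂))) ∈
        adelicMpTheta F ((n × m₁) ⊕ (n × m₂)) (Matrix.fromBlocks (TV ⊗ₖ T₁) 0 0 (TV ⊗ₖ T₂)) ↔
      (S p : adelicMp F (n × (m₁ ⊕ m₂)) (TV ⊗ₖ Matrix.fromBlocks T₁ 0 0 T₂)) ∈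
        adelicMpTheta F (n × (m₁ ⊕ m₂)) (TV ⊗ₖ Matrix.fromBlocks T₁ 0 0 T₂) :=
  kronSumTransport_mem_adelicMpTheta_iff F TV T₁ T₂ (S p)

/-- `ω(kronSeesawSplitting S p) Ψ = R_e (ω(S p) (R_e⁻¹ Ψ))`. [cite: MoeglinVignerasWaldspurger1987, Chap. 2 II.1 (B)] -/
theorem omega_kronSeesawSplitting_apply (p : P) (Ψ : piSchwartzBruhat F ((n × m₁) ⊕ (n × m₂))) :
    adelicMpCont.omega F ((n × m₁) ⊕ (n × m₂)) (Matrix.fromBlocks (TV ⊗ₖ T₁) 0 0 (TV ⊗ₖ T₂))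
        (kronSeesawSplitting S p) Ψ =
      piSBReindex F (Equiv.prodSumDistrib n m₁ m₂)
        (adelicMpCont.omega F (n × (m₁ ⊕ m₂)) (TV ⊗ₖ Matrix.fromBlocks T₁ 0 0 T₂) (S p)
          ((piSBReindex F (Equiv.prodSumDistrib n m₁ m₂)).symm Ψ)) :=
  omega_kronSumTransport_apply F TV T₁ T₂ (S p) Ψ

/-- `π(kronSeesawSplitting S p) w = W_e (π(S p) (W_e⁻¹ w))`. [cite: MoeglinVignerasWaldspurger1987, Chap. 2 II.1 (A)] -/
theorem coe_proj_kronSeesawSplitting_apply (p : P)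
    (w : (((n × m₁) ⊕ (n × m₂)) → AdeleRing (𝓞 F) F) × (((n × m₁) ⊕ (n × m₂)) → AdeleRing (𝓞 F) F)) :
    ((adelicMpCont.proj F ((n × m₁) ⊕ (n × m₂)) (Matrix.fromBlocks (TV ⊗ₖ T₁) 0 0 (TV ⊗ₖ T₂))
          (kronSeesawSplitting S p) :
        symplecticGroup (polar (adelicForm F ((n × m₁) ⊕ (n × m₂)) (Matrix.fromBlocks (TV ⊗ₖ T₁) 0 0 (TV ⊗ₖ T₂))))) :
        ((((n × m₁) ⊕ (n × m₂)) → AdeleRing (𝓞 F) F) × (((n × m₁) ⊕ (n × m₂)) → AdeleRing (𝓞 F) F)) ≃ₗ[AdeleRing (𝓞 F) F]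
          ((((n × m₁) ⊕ (n × m₂)) → AdeleRing (𝓞 F) F) × (((n × m₁) ⊕ (n × m₂)) → AdeleRing (𝓞 F) F))) w =
      UnitaryGroup.reindexW (AdeleRing (𝓞 F) F) (Equiv.prodSumDistrib n m₁ m₂)
        (((adelicMpCont.proj F (n × (m₁ ⊕ m₂)) (TV ⊗ₖ Matrix.fromBlocks T₁ 0 0 T₂) (S p) :
            symplecticGroup (polar (adelicForm F (n × (m₁ ⊕ m₂)) (TV ⊗ₖ Matrix.fromBlocks T₁ 0 0 T₂)))) :
            (((n × (m₁ ⊕ m₂)) → AdeleRing (𝓞 F) F) × ((n × (m₁ ⊕ m₂)) → AdeleRing (𝓞 F) F)) ≃ₗ[AdeleRing (𝓞 F) F]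
              (((n × (m₁ ⊕ m₂)) → AdeleRing (𝓞 F) F) × ((n × (m₁ ⊕ m₂)) → AdeleRing (𝓞 F) F)))
          ((UnitaryGroup.reindexW (AdeleRing (𝓞 F) F) (Equiv.prodSumDistrib n m₁ m₂)).symm w)) :=
  coe_proj_kronSumTransport_apply F TV T₁ T₂ (S p) w

variable
  (hS : ∀ p : P,
    (UnitaryGroup.spReindex (Equiv.prodSumDistrib n m₁ m₂) (TV ⊗ₖ Matrix.fromBlocks T₁ 0 0 T₂)
        (adelicMpCont.proj F (n × (m₁ ⊕ m₂)) (TV ⊗ₖ Matrix.fromBlocks T₁ 0 0 T₂) (S p))).1 =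
      (UnitaryGroup.spSum (TV ⊗ₖ T₁) (TV ⊗ₖ T₂)
        (adelicMpCont.proj F (n × m₁) (TV ⊗ₖ T₁) (s₁ p), adelicMpCont.proj F (n × m₂) (TV ⊗ₖ T₂) (s₂ p))).1)
  (hT₁ : IsUnit (TV ⊗ₖ T₁)) (hT₂ : IsUnit (TV ⊗ₖ T₂))

include hS in
/-- **The hypothesis `hs` of `mpSeesawChar` holds for the block-sum splitting**:
`π(kronSeesawSplitting S p) = π(s₁ p) ⊕ π(s₂ p)`. [cite: Kudla1984, §1] -/
theorem proj_kronSeesawSplitting (p : P) :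
    adelicMpCont.proj F ((n × m₁) ⊕ (n × m₂)) (Matrix.fromBlocks (TV ⊗ₖ T₁) 0 0 (TV ⊗ₖ T₂))
        (kronSeesawSplitting S p) =
      UnitaryGroup.spSum (TV ⊗ₖ T₁) (TV ⊗ₖ T₂)
        (adelicMpCont.proj F (n × m₁) (TV ⊗ₖ T₁) (s₁ p), adelicMpCont.proj F (n × m₂) (TV ⊗ₖ T₂) (s₂ p)) :=
  Subtype.ext (LinearEquiv.ext fun w =>
    (coe_proj_kronSeesawSplitting_apply S p w).trans (LinearEquiv.congr_fun (hS p) w))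

/-- **THE SEE-SAW CHARACTER IN KRONECKER COORDINATES** `χ : P →* ℂˣ` — `mpSeesawChar` of the block-sum splitting
`kronSeesawSplitting S` against `s₁, s₂`. (cf. R. Howe (1979) §3; S. Kudla (1984) §1) [folklore] -/
def mpSeesawCharKron : P →* ℂˣ :=
  mpSeesawChar (kronSeesawSplitting S) s₁ s₂ (proj_kronSeesawSplitting S s₁ s₂ hS) hT₁ hT₂

/-- By definition `mpSeesawCharKron S s₁ s₂ = mpSeesawChar (kronSeesawSplitting S) s₁ s₂` — so every statement of
`AdelicMetaplecticSeesawCharacter` applies to it. [folklore] -/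
theorem mpSeesawCharKron_def :
    mpSeesawCharKron S s₁ s₂ hS hT₁ hT₂ =
      mpSeesawChar (kronSeesawSplitting S) s₁ s₂ (proj_kronSeesawSplitting S s₁ s₂ hS) hT₁ hT₂ :=
  rfl

/-- **The defining identity in block-sum coordinates**:
`R_e (ω(S p) (R_e⁻¹ (Φ₁ ⊠ Φ₂))) = χ(p) • (ω(s₁ p) Φ₁ ⊠ ω(s₂ p) Φ₂)`. [folklore] -/
theorem mpSeesawCharKron_spec' (p : P) (Φ₁ : piSchwartzBruhat F (n × m₁)) (Φ₂ : piSchwartzBruhat F (n × m₂)) :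
    piSBReindex F (Equiv.prodSumDistrib n m₁ m₂)
        (adelicMpCont.omega F (n × (m₁ ⊕ m₂)) (TV ⊗ₖ Matrix.fromBlocks T₁ 0 0 T₂) (S p)
          (kronTensor F Φ₁ Φ₂)) =
      (mpSeesawCharKron S s₁ s₂ hS hT₁ hT₂ p : ℂ) •
        tensorToSum F (n × m₁) (n × m₂) (adelicMpCont.omega F (n × m₁) (TV ⊗ₖ T₁) (s₁ p) Φ₁)
          (adelicMpCont.omega F (n × m₂) (TV ⊗ₖ T₂) (s₂ p) Φ₂) :=
  (omega_kronSeesawSplitting_apply S p (tensorToSum F (n × m₁) (n × m₂) Φ₁ Φ₂)).symm.trans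
    (mpSeesawChar_spec (kronSeesawSplitting S) s₁ s₂ (proj_kronSeesawSplitting S s₁ s₂ hS) hT₁ hT₂ p Φ₁ Φ₂)

/-- **The defining identity in Kronecker coordinates**:
`ω(S p) (kronTensor Φ₁ Φ₂) = χ(p) • kronTensor (ω(s₁ p) Φ₁) (ω(s₂ p) Φ₂)`. [folklore] -/
theorem mpSeesawCharKron_spec (p : P) (Φ₁ : piSchwartzBruhat F (n × m₁)) (Φ₂ : piSchwartzBruhat F (n × m₂)) :
    adelicMpCont.omega F (n × (m₁ ⊕ m₂)) (TV ⊗ₖ Matrix.fromBlocks T₁ 0 0 T₂) (S p) (kronTensor F Φ₁ Φ₂) =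
      (mpSeesawCharKron S s₁ s₂ hS hT₁ hT₂ p : ℂ) •
        kronTensor F (adelicMpCont.omega F (n × m₁) (TV ⊗ₖ T₁) (s₁ p) Φ₁)
          (adelicMpCont.omega F (n × m₂) (TV ⊗ₖ T₂) (s₂ p) Φ₂) := by
  have h := congrArg (piSBReindex F (Equiv.prodSumDistrib n m₁ m₂)).symm
    (mpSeesawCharKron_spec' S s₁ s₂ hS hT₁ hT₂ p Φ₁ Φ₂)
  exact (((piSBReindex F (Equiv.prodSumDistrib n m₁ m₂)).symm_apply_apply _).symm.trans h).trans
    (LinearEquiv.map_smul _ _ _)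

/-- **`χ(p) = 1` when the three values are `Θ`-fixing** (rational points). [cite: Weil1964, Chap. III n° 41 Thm 6 p. 193] -/
theorem mpSeesawCharKron_eq_one_of_mem_adelicMpTheta {p : P}
    (hp : (S p : adelicMp F (n × (m₁ ⊕ m₂)) (TV ⊗ₖ Matrix.fromBlocks T₁ 0 0 T₂)) ∈
      adelicMpTheta F (n × (m₁ ⊕ m₂)) (TV ⊗ₖ Matrix.fromBlocks T₁ 0 0 T₂))
    (hp₁ : (s₁ p : adelicMp F (n × m₁) (TV ⊗ₖ T₁)) ∈ adelicMpTheta F (n × m₁) (TV ⊗ₖ T₁))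
    (hp₂ : (s₂ p : adelicMp F (n × m₂) (TV ⊗ₖ T₂)) ∈ adelicMpTheta F (n × m₂) (TV ⊗ₖ T₂)) :
    mpSeesawCharKron S s₁ s₂ hS hT₁ hT₂ p = 1 :=
  mpSeesawChar_eq_one_of_mem_adelicMpTheta _ _ _ _ hT₁ hT₂
    ((kronSeesawSplitting_mem_adelicMpTheta_iff S p).2 hp) hp₁ hp₂

end Seesaw

/-! ### Build-lane note (ops-buildfix G11b-3 recipe, LEDGER B13-1, 2026-08-21)
`lean -o` (the hub build lane, never `lean`/the gate check) runs Lean 4.32's library-suggestion indexers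
(`Lean.LibrarySuggestions.SymbolFrequency` / `SineQuaNon`, from their `exportEntriesFn`) over the statement of
every local theorem that is not a denied premise; on this family's statements (very large dependent binder
telescopes through the theta-kernel / dual-pair data) that fold runs for tens of minutes to hours and the build
lane kills the job (incident G11b-3, run/shared/lean/ops/buildfix/G11b-3-DOSSIER.md). `isDeniedPremise` skips
`[implicit_reducible]` constants before any fold, and a reducibility status on a *theorem* is inert (Meta never
unfolds `thmInfo`; the kernel ignores the attribute), so the public theorems of this file are tagged
`[implicit_reducible]` purely to keep them out of that index. Only other effect: they are not offered by
`+suggestions` premise selectors. No statement or proof is changed; superseded if the operator lands a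
deny-list form (`HarnessLib.PremiseIndex`). -/
set_option allowUnsafeReducibility true in
attribute [implicit_reducible]
  fromBlocks_kronecker_mul_one kronSumTransport_apply continuous_kronSumTransport
  kronSumTransport_mem_adelicMpTheta_iff omega_kronSumTransport_apply relabelVec_one_symm_apply
  relabelVec_one_apply coe_proj_adelicMpRelabel_one_apply coe_proj_kronSumTransport_apply
  kronTensor_def piSBReindex_kronTensor coe_kronTensor_apply kronTensor_add_left
  kronTensor_add_right kronTensor_smul kronSeesawSplitting_apply continuous_kronSeesawSplitting
  kronSeesawSplitting_mem_adelicMpTheta_iff omega_kronSeesawSplitting_apply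
  coe_proj_kronSeesawSplitting_apply proj_kronSeesawSplitting mpSeesawCharKron_def
  mpSeesawCharKron_spec' mpSeesawCharKron_spec mpSeesawCharKron_eq_one_of_mem_adelicMpTheta

end Literature.NumberTheory.Weil1964

end
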